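import Summits.BirchSwinnertonDyer.Rank1Residual.WAll.Target
import Summits.BirchSwinnertonDyer.BirchSwinnertonDyer.Theorems.Rank1ResidualX9Defs
import Literature.NumberTheory.EllipticCurves.Rank1Residual.Dedup
import Literature.NumberTheory.EllipticCurves.Rank1Residual.ClassX1KellerYinCertificate
import HarnessLib

/-!
# Class X9: the W-ALL/9 corner and the K6 leaf agree — `WAllCornerX9 ⟹ BSDpOnClassX9` via JSW 2017 Thm. 1.2.1

Print-tier cell `bsd-print-x9` (D-0131 (2), key `x9`), typer seat ty2 (discharge interface). Theorems
only: no definition, no new named fact (D-0014 / D-0026); the one published input enters as the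
explicit binder `hJSW : JetchevSkinnerWan2017.thm121_padicValRat_bsd_rank_one` (a `def … : Prop` of
`Literature/`), next to the two standing print binders of the cell's currency conversions
(`hmod : hasEntireLFunction_rat`, `hGZK : rank_eq_analyticRank_of_analyticRank_le_one`).

THE BOUNDARY (cell referee REF-18, director-bsd currency word 2026-08-27T13:52Z). The cell's print
route `PrintX9` closes the W-ALL/9 corner

  `Summit.BirchSwinnertonDyer.WAllCornerX9 : ∀ W p, Rank1Residual.ClassX9 W p → r_an ≤ 1 → BSDp W p`

stated over the CENSUS predicate `Rank1Residual.ClassX9` of `Rank1Residual/Predicates.lean`, which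
carries the rank-one clause `r_an = 1 → ¬ Semistable W`; the charter leaf of the class (rung K6) is

  `Summit.….Rank1Residual.BSDpOnClassX9 : ∀ W p, r_an ≤ 1 → ClassX9 W p → Finite Ш → PPartBSD W p`

over the Summits-side `ClassX9` of `Theorems/Rank1ResidualX9Defs.lean`, which has NO semistability
clause. The tree had leaf ⟹ corner (`WAll.wallCornerX9_of_bsdpOnClassX9`, via `bsdp_of_bsdpOnClassX9`)
but not corner ⟹ leaf: the gap is exactly the SEMISTABLE analytic-rank-one pairs with `p ≥ 5` good
ordinary, `E[p]` irreducible and `ρ̄_{E,p}` not surjective — and those are covered IN PRINT by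
Jetchev–Skinner–Wan 2017 Thm. 1.2.1 (semistable `E`, `p ≥ 3` of good reduction, (irr), `r_an = 1`,
`Ш` finite; NO surjectivity and NO ordinarity hypothesis; its `p = 3` proviso is vacuous at `p ≥ 5`).

This file is that bridge, hypothesis by hypothesis:

* `pPartBSD_of_thm121_of_semistable` — the semistable rank-one sub-case: the binders of the typed
  JSW fact are fed `3 ≤ p` (from `5 ≤ p`), `W.IsSemistable (𝓞 ℚ)` (from `Semistable W` by the tree's
  `semistable_iff_isSemistable_ringOfIntegers`), good reduction, the `p = 3` clause (dead: `p ≥ 5`),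
  (irr), `r_an = 1`, `Finite Ш`; its product display is the print shape `PPart`
  (`pPart_iff_productShape`) = `PPartBSD` (`pPartBSD_iff_pPart`);
* `bsdp_of_thm121_of_semistable` — the same in Miller's currency `BSDp` (`bsdp_of_pPart`, which
  spends `hmod`, `hGZK`);
* `bsdpOnClassX9_of_wallCornerX9` — THE BRIDGE: case split on `r_an = 1 ∧ Semistable W`; the
  semistable rank-one case is the first lemma, the other case IS a census-`ClassX9` pair, where the
  corner gives `BSDp W p` and `pPart_of_bsdp` (`hmod`, `hGZK`) returns the print shape;
* `bsdpOnClassX9_iff_wallCornerX9` — with the existing direction, the two targets are equivalent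
  granted the three print binders; `bsdp_of_wallCornerX9` — the corner read on the Summits-side
  `ClassX9` (no semistability clause) in the currency `BSDp`.

Currency of the bridge = the row of JSW 2017 Thm. 1.2.1 (PUB) + modularity + GZK; nothing else.
Nothing here is a class theorem and nothing is asserted about any curve.

## References (hypotheses quoted from the tree's fact docstrings, which carry the page locators)

* [JetchevSkinnerWan2017] Thm. 1.2.1 (p. 370; 'Thm. 2' of arXiv:1512.06894): `E/ℚ` semistable,
  `p ≥ 3` a prime of good reduction (`a_3 = 0` if `p = 3` supersingular), `E[p]` irreducible,
  `ord_{s=1} L(E,s) = 1` ⟹ `ord_p (L'(E,1)/(Reg·Ω)) = ord_p (#Ш ∏ c_ℓ / #E(ℚ)_tors²)`.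
* [Miller2011LMS] Def. 1.1 (`BSD(E,p)`, the currency `BSDp`).
-/

noncomputable section

open scoped Classical NumberField

open WeierstrassCurve Literature.NumberTheory.EllipticCurves
open Literature.NumberTheory.EllipticCurves.Rank1Residual
open Summit.BirchSwinnertonDyer.BirchSwinnertonDyer.Rank1Residual
  (BSDpOnClassX9 PPartBSD pPartBSD_iff_pPart classX9_of_classX9_census bsdp_of_bsdpOnClassX9)

namespace Summit.BirchSwinnertonDyer.Rank1Residual.X9

/-! ### 1. The semistable rank-one sub-case is in print (JSW 2017 Thm. 1.2.1) -/

/-- **Semistable rank one, print shape.** At a globally minimal `W/ℚ` with `p ≥ 5` of good reduction,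
`E[p]` irreducible, `W` semistable (census predicate `Semistable W`: every prime good or
multiplicative), `ord_{s=1} L(E,s) = 1` and `Ш(E)` finite, Jetchev–Skinner–Wan 2017 Thm. 1.2.1
(`hJSW`, binders fed verbatim: `3 ≤ p` from `5 ≤ p`; `W.IsSemistable (𝓞 ℚ)` from `Semistable W`;
the `p = 3` proviso vacuous) gives the `p`-part of BSD in the print shape `PPartBSD`. No surjectivity,
no ordinarity is used. [cite: JetchevSkinnerWan2017, Thm. 1.2.1 (p. 370)] -/
theorem pPartBSD_of_thm121_of_semistable
    (hJSW : JetchevSkinnerWan2017.thm121_padicValRat_bsd_rank_one)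
    (W : WeierstrassCurve ℚ) [W.IsElliptic] [W.IsGloballyMinimal] (p : ℕ) [Fact p.Prime]
    (h5 : 5 ≤ p) (hgood : W.HasGoodReductionAtPrime p) (hirr : W.HasIrreducibleModPGaloisRep p)
    (hsst : Semistable W) (hr : W.analyticRank = 1) (hfin : Finite W.sha) : PPartBSD W p := by
  have hsstO : W.IsSemistable (𝓞 ℚ) := (semistable_iff_isSemistable_ringOfIntegers W).mp hsst
  have h3 : p = 3 → (3 : ℤ) ∣ W.frobeniusTrace 3 → W.frobeniusTrace 3 = 0 := by
    rintro rfl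
    omega
  have hdisp := hJSW W p (by omega) hsstO hgood h3 hirr hr hfin
  exact (pPartBSD_iff_pPart W p).mpr ((pPart_iff_productShape W p).mpr hdisp)

/-- **Semistable rank one, Miller's currency.** The same sub-case concluded as `BSD(E,p)`
(`bsdp_of_pPart`, spending modularity `hmod` and Gross–Zagier–Kolyvagin `hGZK`, which also supplies
`Finite Ш`). [cite: JetchevSkinnerWan2017, Thm. 1.2.1 (p. 370)] [cite: Miller2011LMS, Def. 1.1] -/
theorem bsdp_of_thm121_of_semistable (hmod : hasEntireLFunction_rat)
    (hGZK : rank_eq_analyticRank_of_analyticRank_le_one)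
    (hJSW : JetchevSkinnerWan2017.thm121_padicValRat_bsd_rank_one)
    (W : WeierstrassCurve ℚ) [W.IsElliptic] [W.IsGloballyMinimal] (p : ℕ) [Fact p.Prime]
    (h5 : 5 ≤ p) (hgood : W.HasGoodReductionAtPrime p) (hirr : W.HasIrreducibleModPGaloisRep p)
    (hsst : Semistable W) (hr : W.analyticRank = 1) : BSDp W p :=
  bsdp_of_pPart W p hmod hGZK hr.le ((pPartBSD_iff_pPart W p).mp
    (pPartBSD_of_thm121_of_semistable hJSW W p h5 hgood hirr hsst hr (hGZK W hr.le).2))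

/-! ### 2. The bridge: W-ALL/9 corner ⟹ K6 leaf -/

/-- **THE BRIDGE `WAllCornerX9 ⟹ BSDpOnClassX9`** (director-bsd currency word 2026-08-27T13:52Z;
referee REF-18). Given modularity (`hmod`), Gross–Zagier–Kolyvagin (`hGZK`) and Jetchev–Skinner–Wan
2017 Thm. 1.2.1 (`hJSW`), a closure of the W-ALL/9 corner (census predicate, with the clause
`r_an = 1 → ¬ Semistable W`) closes the K6 leaf (Summits-side `ClassX9`, no semistability clause):
on a pair with `r_an = 1 ∧ Semistable W` the leaf's conclusion is JSW Thm. 1.2.1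
(`pPartBSD_of_thm121_of_semistable`); otherwise the pair satisfies the census predicate, the corner
gives `BSDp W p`, and `pPart_of_bsdp` returns the print shape. [cite: JetchevSkinnerWan2017, Thm. 1.2.1 (p. 370)]
[cite: Miller2011LMS, Def. 1.1] -/
theorem bsdpOnClassX9_of_wallCornerX9 (hmod : hasEntireLFunction_rat)
    (hGZK : rank_eq_analyticRank_of_analyticRank_le_one)
    (hJSW : JetchevSkinnerWan2017.thm121_padicValRat_bsd_rank_one)
    (h : Summit.BirchSwinnertonDyer.WAllCornerX9) : BSDpOnClassX9 := by
  intro W _ _ p _ hr hX hfin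
  obtain ⟨hcm, h5, hgood, hap, hirr, hns⟩ := hX
  by_cases hs : W.analyticRank = 1 ∧ Semistable W
  · exact pPartBSD_of_thm121_of_semistable hJSW W p h5 hgood hirr hs.2 hs.1 hfin
  · have hX' : ClassX9 W p := ⟨hcm, ⟨hgood, hap⟩, h5, hirr, hns, fun h1 hsst => hs ⟨h1, hsst⟩⟩
    exact (pPartBSD_iff_pPart W p).mpr (pPart_of_bsdp hmod hGZK W p hr (h W p hX' hr))

/-- **The two targets are equivalent** granted modularity, GZK and JSW Thm. 1.2.1: leaf ⟹ corner is
the tree's `bsdp_of_bsdpOnClassX9` (no JSW needed), corner ⟹ leaf is `bsdpOnClassX9_of_wallCornerX9`.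
[cite: JetchevSkinnerWan2017, Thm. 1.2.1 (p. 370)] [cite: Miller2011LMS, Def. 1.1] -/
theorem bsdpOnClassX9_iff_wallCornerX9 (hmod : hasEntireLFunction_rat)
    (hGZK : rank_eq_analyticRank_of_analyticRank_le_one)
    (hJSW : JetchevSkinnerWan2017.thm121_padicValRat_bsd_rank_one) :
    BSDpOnClassX9 ↔ Summit.BirchSwinnertonDyer.WAllCornerX9 :=
  ⟨fun h W _ _ p _ hX hr => bsdp_of_bsdpOnClassX9 hmod hGZK h W p hr hX,
    bsdpOnClassX9_of_wallCornerX9 hmod hGZK hJSW⟩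

/-- **The corner read on the Summits-side class predicate, Miller's currency**: granted the three
print binders, a closure of `WAllCornerX9` gives `BSD(E,p)` at EVERY pair with
`Rank1ResidualX9Defs.ClassX9 W p` (non-CM, `p ≥ 5` good ordinary, (irr), not surjective — no
semistability clause) and `r_an ≤ 1`. [cite: JetchevSkinnerWan2017, Thm. 1.2.1 (p. 370)]
[cite: Miller2011LMS, Def. 1.1] -/
theorem bsdp_of_wallCornerX9 (hmod : hasEntireLFunction_rat)
    (hGZK : rank_eq_analyticRank_of_analyticRank_le_one)
    (hJSW : JetchevSkinnerWan2017.thm121_padicValRat_bsd_rank_one)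
    (h : Summit.BirchSwinnertonDyer.WAllCornerX9)
    (W : WeierstrassCurve ℚ) [W.IsElliptic] [W.IsGloballyMinimal] (p : ℕ) [Fact p.Prime]
    (hr : W.analyticRank ≤ 1)
    (hX : Summit.BirchSwinnertonDyer.BirchSwinnertonDyer.Rank1Residual.ClassX9 W p) : BSDp W p := by
  by_cases hs : W.analyticRank = 1 ∧ Semistable W
  · exact bsdp_of_thm121_of_semistable hmod hGZK hJSW W p hX.2.1 hX.2.2.1 hX.2.2.2.2.1 hs.2 hs.1
  · exact h W p ⟨hX.1, ⟨hX.2.2.1, hX.2.2.2.1⟩, hX.2.1, hX.2.2.2.2.1, hX.2.2.2.2.2,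
      fun h1 hsst => hs ⟨h1, hsst⟩⟩ hr

end Summit.BirchSwinnertonDyer.Rank1Residual.X9

end
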